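import Summits.HodgeConjecture.HodgeConjecture.Theorems.Ring2WeilCoveragePfaffianForm
import Literature.Geometry.Kaehler.ComplexTorusTypeOfPolarization
import HarnessLib

/-!
# Weil-type family coverage — the placement law in LATTICE form: `(-1)ⁿ det H = [Λ : Λ₀] · d₁ ⋯ d_g`

research route conditional on HC_CM; not a corollary; Q11.4-sentence-2 already refuted in dim ≥ 3.

Ring 2, WEIL-TYPE FAMILY-COVERAGE CENSUS (`HOME/WEIL-FAMILY-COVERAGE.md` §b04.5, split-special-fibre
column, owner ring2-b04). The gen-41 file `Ring2WeilCoveragePfaffianForm` proved, at MATRIX level, that the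
rational Gram determinant of the alternating form `E` on a `K`-frame `{xᵢ, φ^* xᵢ}` is `(det Ψ)²`
(`Ψ = a + b√-d` van Geemen's Hermitian Gram matrix), and read off `det Ψ = (-1)ⁿ c` from `det Std = c²`.
What was left to prose there (block b04.5 (T)+(S): "integral frame ⟹ `det Std = ([Λ:Λ₀]·d₁⋯d_{2n})²`")
is made a theorem here, ON THE TREE'S CARRIERS for polarised complex tori
(`Literature/Geometry/Kaehler/ComplexTorusTypeOfPolarization.lean`: `ComplexTorus.IsPolarizationType Φ ω d`
= "`ω` is of type `(d₁, …, d_g)` on the lattice of `X = E/Φ(ℤ^ι)`", `ComplexTorus.latticeGram`):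

* `det_transpose_mul_mul` — `det (ᵗP G P) = (det P)² det G` (any commutative ring);
* `frameGram_eq_transpose_mul_mul` — for lattice vectors `y₁, …, y_m ∈ ℤ^ι` with integer coordinate matrix
  `P` (columns), the Gram matrix `(ω(Φyⱼ, Φyⱼ'))` of the lattice form on the frame is `ᵗP · G · P`;
* `det_frameGram_eq_sq` — if `ω` is of type `d = (d₁, …, d_g)`, then for ANY full frame `y` (square integer
  coordinate matrix `P`): `det (ω(Φyⱼ, Φyⱼ')) = (det P · d₁⋯d_g)²` ([BL §3.1]: type = elementary divisors of
  `E|_Λ`, `det E|_Λ = (d₁⋯d_g)²`, tree `IsPolarizationType.det_latticeGram`; plus change of basis);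
* `index_span_frame_eq_natAbs_det` — `[ℤ^ι : ℤy₁ + ⋯ + ℤy_{|ι|}] = |det P|` (Mathlib
  `AddSubgroup.index_eq_natAbs_det`), so `|det P|` IS the lattice index `[Λ : Λ₀]` of b04.5;
* `det_weilStdGramMatrix_eq_sq_of_frame`, `neg_one_pow_mul_det_eq_natAbs_of_frame`,
  `mk_det_eq_splitDiscriminantClass_iff_of_frame` — **THE PLACEMENT LAW**: if the frame is a `K`-frame, i.e.
  its Gram matrix is ab-weil-1's `weilStdGramMatrix n d a b = [[b, a], [-a, d b]]` (`a` symmetric, `b`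
  antisymmetric: the Gram data of `Ψ = a + b√-d`), and `det Ψ = q` has the Weil-type sign `(-1)ⁿ q > 0`, then
  **`(-1)ⁿ q = |det P| · d₁⋯d_g` exactly** (as rational numbers), hence `[q]` is the SPLIT class of
  `ℚˣ/Nm(K_dˣ)` iff `|det P| · d₁⋯d_g ∈ Nm(K_dˣ)` — b04.5's "`a(P, K) ≡ [Λ:Λ₀]·d₁⋯d_{2n} mod Nm(Kˣ)`", with
  the congruence sharpened to an equality of integers for the frame's own `Λ₀ = ℤ`-span of the frame
  (ring2-b02 g51's check b02.11 "the law holds EXACTLY as integers in 1149/1149 cases" is this identity).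

Everything is bookkeeping around two facts already in the tree (`det_latticeGram`, gen-41's
`det_eq_neg_one_pow_mul_of_sq`); no `def`, no named fact, no `sorry`. Nothing here is a statement about
Hodge classes and `HC_CM` is used nowhere.

References: [cite: Lange2023AbelianVarietiesComplex, §1.5.1 (type), §1.5.3 (`Pf(E) = det D`), §1.7.1
(`det E = Pf(E)²`)]; [cite: vanGeemen1994HodgeAV, Lemma 5.2 and (5.4.1)] (`H = E(·, φ^*·) + √-d E`,
`det H = (-1)ⁿ a`, hyperbolic iff `a ∈ Nm K^*`); Birkenhake–Lange, *Complex Abelian Varieties* §3.1.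
-/

set_option linter.dupNamespace false

open Matrix
open Literature.AlgebraicGeometry.Motives (normUnitsSubgroup)
open Literature.AlgebraicGeometry.VanGeemen1994
open Literature.Geometry.Kaehler.ComplexTorus
open Summit.HodgeConjecture.HodgeConjecture.Ring2.Hypotheses
open Summit.HodgeConjecture.HodgeConjecture.Ring2.AbelianAll (weilStdGramMatrix)

namespace Summit.HodgeConjecture.HodgeConjecture.Ring2.WeilCoverage

/-! ### §1 Matrix bookkeeping over a commutative ring -/

section CommRing

variable {R : Type*} [CommRing R] {ι κ : Type*} [Fintype ι]

/-- `det (ᵗP · G · P) = (det P)² · det G` — the Gram determinant of a form changes by the SQUARE of the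
determinant of the change of frame.
research route conditional on HC_CM; not a corollary; Q11.4-sentence-2 already refuted in dim ≥ 3. [folklore] -/
theorem det_transpose_mul_mul [DecidableEq ι] (G P : Matrix ι ι R) :
    (Pᵀ * G * P).det = P.det ^ 2 * G.det := by
  rw [det_mul, det_mul, det_transpose]
  ring

/-- Entries of `ᵗP · G · P`: the `(j, j')` entry is the value `ᵗyⱼ G yⱼ'` of the bilinear form with Gram
matrix `G` on the columns `yⱼ = P eⱼ`, `yⱼ' = P eⱼ'` (rectangular `P` allowed).
research route conditional on HC_CM; not a corollary; Q11.4-sentence-2 already refuted in dim ≥ 3. [folklore] -/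
theorem transpose_mul_mul_apply (G : Matrix ι ι R) (P : Matrix ι κ R) (j j' : κ) :
    (Pᵀ * G * P) j j' = (fun i => P i j) ⬝ᵥ G *ᵥ (fun i => P i j') := by
  rw [Matrix.mul_assoc, Matrix.mul_apply]
  refine Finset.sum_congr rfl fun i _ => ?_
  rw [transpose_apply, Matrix.mul_apply]
  rfl

end CommRing

/-! ### §2 Frames in the lattice of a polarised complex torus -/

section Torus

variable {ι : Type*} [Fintype ι] [DecidableEq ι] {E : Type*} [NormedAddCommGroup E] [NormedSpace ℂ E]
  (Φ : (ι → ℝ) ≃L[ℝ] E) (ω : E [⋀^Fin 2]→L[ℝ] ℝ)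

/-- **Frame Gram = `ᵗP G P`.** For lattice vectors `yⱼ ∈ ℤ^ι` (`j ∈ κ`) with integer coordinate matrix
`P = (yⱼ(i))ᵢⱼ` (columns = the `yⱼ`), the Gram matrix of the lattice form `E_Λ(x, y) = ω(Φx, Φy)` on the
frame is `ᵗP · G · P`, `G = latticeGram Φ ω` the Gram matrix on the lattice basis.
research route conditional on HC_CM; not a corollary; Q11.4-sentence-2 already refuted in dim ≥ 3.
[cite: Lange2023AbelianVarietiesComplex, §1.5.1 (the matrix of `E` with respect to a basis of `Λ`)] -/
theorem frameGram_eq_transpose_mul_mul {κ : Type*} [Fintype κ] [DecidableEq κ] (P : Matrix ι κ ℤ)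
    (j j' : κ) :
    ω ![Φ (intVec fun i => P i j), Φ (intVec fun i => P i j')] =
      ((P.map (Int.cast : ℤ → ℝ))ᵀ * latticeGram Φ ω * P.map (Int.cast : ℤ → ℝ)) j j' := by
  rw [transpose_mul_mul_apply, dotProduct_latticeGram_mulVec]
  rfl

/-- **`det (ω(Φyⱼ, Φyⱼ')) = (det P · d₁⋯d_g)²`** for a form of type `(d₁, …, d_g)` and any `|ι|` lattice
vectors `yⱼ` with (square) integer coordinate matrix `P`: the Gram determinant on the frame is the square of
(change-of-frame determinant) × (Pfaffian `d₁⋯d_g`). With `P` unimodular this is the tree's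
`IsPolarizationType.det_latticeGram`; in general `|det P| = [ℤ^ι : Σ ℤyⱼ]` (`index_span_frame_eq_natAbs_det`).
research route conditional on HC_CM; not a corollary; Q11.4-sentence-2 already refuted in dim ≥ 3.
[cite: Lange2023AbelianVarietiesComplex, §1.5.3 (`Pf(E) = det D`) and §1.7.1 (`det E = Pf(E)²`)] -/
theorem det_frameGram_eq_sq {g : ℕ} {d : Fin g → ℕ} (hd : IsPolarizationType Φ ω d)
    (P : Matrix ι ι ℤ) :
    (Matrix.of fun j j' => ω ![Φ (intVec fun i => P i j), Φ (intVec fun i => P i j')]).det =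
      ((P.det : ℝ) * ∏ i, (d i : ℝ)) ^ 2 := by
  have h : (Matrix.of fun j j' => ω ![Φ (intVec fun i => P i j), Φ (intVec fun i => P i j')]) =
      (P.map (Int.cast : ℤ → ℝ))ᵀ * latticeGram Φ ω * P.map (Int.cast : ℤ → ℝ) := by
    ext j j'
    rw [of_apply, frameGram_eq_transpose_mul_mul]
  rw [h, det_transpose_mul_mul, hd.det_latticeGram, ← Int.cast_det]
  ring

/-- **`[ℤ^ι : ℤy₁ + ⋯ + ℤy_{|ι|}] = |det P|`**: the index of the subgroup generated by a full frame of lattice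
vectors is the absolute value of the determinant of its integer coordinate matrix (Smith normal form;
Mathlib `AddSubgroup.index_eq_natAbs_det`). This identifies the factor `|det P|` of `det_frameGram_eq_sq`
with the lattice index `[Λ : Λ₀]` of `WEIL-FAMILY-COVERAGE.md` b04.5.
research route conditional on HC_CM; not a corollary; Q11.4-sentence-2 already refuted in dim ≥ 3.
[cite: Lange2023AbelianVarietiesComplex, §1.1.2 proof of Prop. 1.1.13 (c) (index = `|det|`)] -/
theorem index_span_frame_eq_natAbs_det (P : Matrix ι ι ℤ) (hP : P.det ≠ 0) :
    (LinearMap.range (Matrix.toLin' P)).toAddSubgroup.index = P.det.natAbs := by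
  have hinj : Function.Injective (Matrix.toLin' P) := by
    rw [← LinearMap.ker_eq_bot, Matrix.ker_toLin'_eq_bot_iff]
    intro v hv
    by_contra h
    exact hP (Matrix.exists_mulVec_eq_zero_iff.mp ⟨v, h, hv⟩)
  let e : (ι → ℤ) ≃ₗ[ℤ] LinearMap.range (Matrix.toLin' P) := LinearEquiv.ofInjective _ hinj
  let bR : Module.Basis ι ℤ (LinearMap.range (Matrix.toLin' P)) := (Pi.basisFun ℤ ι).map e
  have hbR : ∀ j, ((bR j : LinearMap.range (Matrix.toLin' P)) : ι → ℤ) = fun i => P i j := by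
    intro j
    rw [Module.Basis.map_apply, LinearEquiv.ofInjective_apply, Pi.basisFun_apply, Matrix.toLin'_apply]
    funext i
    rw [Matrix.mulVec, dotProduct]
    simp [Pi.single_apply]
  rw [AddSubgroup.index_eq_natAbs_det (Pi.basisFun ℤ ι) (LinearMap.range (Matrix.toLin' P)).toAddSubgroup
    bR, Module.Basis.det_apply]
  congr 2
  ext i j
  rw [Module.Basis.toMatrix_apply, Pi.basisFun_repr]
  exact congrFun (hbR j) i

/-- The subgroup generated by the frame is the `ℤ`-span of the columns of `P` (bookkeeping for
`index_span_frame_eq_natAbs_det`).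
research route conditional on HC_CM; not a corollary; Q11.4-sentence-2 already refuted in dim ≥ 3. [folklore] -/
theorem range_toLin'_eq_span_cols (P : Matrix ι ι ℤ) :
    LinearMap.range (Matrix.toLin' P) = Submodule.span ℤ (Set.range fun j => fun i => P i j) := by
  rw [Matrix.toLin'_apply', Matrix.range_mulVecLin]
  rfl

end Torus

/-! ### §3 `K`-frames: the placement law `(-1)ⁿ det Ψ = |det P| · d₁⋯d_g` -/

section Weil

variable {ι : Type*} {E : Type*} [NormedAddCommGroup E] [NormedSpace ℂ E]
  {Φ : (ι → ℝ) ≃L[ℝ] E} {ω : E [⋀^Fin 2]→L[ℝ] ℝ} {g : ℕ} {dtyp : Fin g → ℕ}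
  {n d : ℕ} {a b : Matrix (Fin (2 * n)) (Fin (2 * n)) ℚ} {q : ℚ}

/-- **`det Std = (det P · d₁⋯d_g)²`.** If a frame of `4n = |ι|` lattice vectors `yⱼ = P e'ⱼ` (`e : Fin (4n) ≃ ι`
an enumeration of the lattice basis, `P` the integer coordinate matrix in that enumeration) is a `K`-FRAME —
its Gram matrix for the lattice form is `weilStdGramMatrix n d a b = [[b, a], [-a, d·b]]`, the shape
`pairFrame_gram` of `{xᵢ, φ^*xᵢ}` — then the rational Gram determinant is `(det P · d₁⋯d_g)²`.
research route conditional on HC_CM; not a corollary; Q11.4-sentence-2 already refuted in dim ≥ 3.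
[cite: Lange2023AbelianVarietiesComplex, §1.7.1 (`det E = Pf(E)²`)] -/
theorem det_weilStdGramMatrix_eq_sq_of_frame (hd : IsPolarizationType Φ ω dtyp) (e : Fin (4 * n) ≃ ι)
    (P : Matrix (Fin (4 * n)) (Fin (4 * n)) ℤ)
    (hF : (Matrix.of fun j j' =>
        ω ![Φ (intVec fun i => P (e.symm i) j), Φ (intVec fun i => P (e.symm i) j')]) =
      (weilStdGramMatrix n d a b).map (Rat.cast : ℚ → ℝ)) :
    (weilStdGramMatrix n d a b).det = (((P.det * ∏ i, (dtyp i : ℤ) : ℤ) : ℚ)) ^ 2 := by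
  -- transport the torus along `e` so that the lattice is indexed by `Fin (4 * n)`
  let Φ' : (Fin (4 * n) → ℝ) ≃L[ℝ] E := (LinearEquiv.funCongrLeft ℝ ℝ e.symm).toContinuousLinearEquiv.trans Φ
  have hΦ' : ∀ v : Fin (4 * n) → ℤ, Φ' (intVec v) = Φ (intVec fun i => v (e.symm i)) := by
    intro v
    rfl
  have hd' : IsPolarizationType Φ' ω dtyp := by
    obtain ⟨hchain, bs, huu, hvv, huv⟩ := hd
    let L : (ι → ℤ) ≃ₗ[ℤ] (Fin (4 * n) → ℤ) := LinearEquiv.funCongrLeft ℤ ℤ e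
    have hL : ∀ w : ι → ℤ, (fun i => (L w) (e.symm i)) = w := by
      intro w
      funext i
      simp [L, LinearEquiv.funCongrLeft_apply]
    refine ⟨hchain, bs.map L, ?_, ?_, ?_⟩
    · intro i j
      rw [Module.Basis.map_apply, Module.Basis.map_apply, hΦ', hΦ', hL, hL, huu]
    · intro i j
      rw [Module.Basis.map_apply, Module.Basis.map_apply, hΦ', hΦ', hL, hL, hvv]
    · intro i j
      rw [Module.Basis.map_apply, Module.Basis.map_apply, hΦ', hΦ', hL, hL, huv]
  have hdet := det_frameGram_eq_sq Φ' ω hd' P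
  have hF' : (Matrix.of fun j j' => ω ![Φ' (intVec fun i => P i j), Φ' (intVec fun i => P i j')]) =
      (weilStdGramMatrix n d a b).map (Rat.cast : ℚ → ℝ) := by
    rw [← hF]
    ext j j'
    rw [of_apply, of_apply, hΦ', hΦ']
  have hmap : ((weilStdGramMatrix n d a b).map (Rat.cast : ℚ → ℝ)).det =
      (((weilStdGramMatrix n d a b).det : ℚ) : ℝ) := by
    rw [← Rat.coe_castHom, ← RingHom.mapMatrix_apply, ← RingHom.map_det]
  rw [hF', hmap] at hdet
  have h' : (((weilStdGramMatrix n d a b).det : ℚ) : ℝ) =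
      (((((P.det * ∏ i, (dtyp i : ℤ) : ℤ) : ℚ)) ^ 2 : ℚ) : ℝ) := by
    rw [hdet, Rat.cast_pow, Rat.cast_intCast, Int.cast_mul, Int.cast_prod]
    simp only [Int.cast_natCast]
  exact_mod_cast h'

/-- **THE PLACEMENT LAW (lattice form): `(-1)ⁿ · det Ψ = |det P| · d₁⋯d_g`** — for a polarised complex torus of
type `(d₁, …, d_g)` and a `K`-frame of lattice vectors with integer coordinate matrix `P` whose Gram data
`(a, b)` are those of a Hermitian `Ψ = a + b√-d` (`a` symmetric, `b` antisymmetric) with `det Ψ = q` of the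
Weil-type sign `(-1)ⁿ q > 0`: the positive number `a(P, K) = (-1)ⁿ det H` of the census is EXACTLY the lattice
index `|det P| = [ℤ^ι : Σⱼ ℤyⱼ]` (`index_span_frame_eq_natAbs_det`) times the polarisation type `d₁⋯d_g`.
research route conditional on HC_CM; not a corollary; Q11.4-sentence-2 already refuted in dim ≥ 3.
[cite: vanGeemen1994HodgeAV, Lemma 5.2 (3)–(4) and (5.4.1)] -/
theorem neg_one_pow_mul_det_eq_natAbs_of_frame (hd : IsPolarizationType Φ ω dtyp) (hdpos : 0 < d)
    (e : Fin (4 * n) ≃ ι) (P : Matrix (Fin (4 * n)) (Fin (4 * n)) ℤ)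
    (hF : (Matrix.of fun j j' =>
        ω ![Φ (intVec fun i => P (e.symm i) j), Φ (intVec fun i => P (e.symm i) j')]) =
      (weilStdGramMatrix n d a b).map (Rat.cast : ℚ → ℝ))
    (ha : a.IsSymm) (hb : bᵀ = -b) (hq : (weilGramMatrix d a b).det = algebraMap ℚ (weilField d) q)
    (hsign : 0 < (-1 : ℚ) ^ n * q) :
    (-1 : ℚ) ^ n * q = ((P.det * ∏ i, (dtyp i : ℤ)).natAbs : ℚ) := by
  have hStd := det_weilStdGramMatrix_eq_sq_of_frame hd e P hF
  set c : ℤ := P.det * ∏ i, (dtyp i : ℤ) with hc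
  have hq0 : q ≠ 0 := by
    rintro rfl
    simp at hsign
  have hc0 : c ≠ 0 := by
    intro h0
    have h1 := det_weilStdGramMatrix_eq_sq hdpos ha hb hq
    rw [hStd, h0] at h1
    exact hq0 (pow_eq_zero_iff two_ne_zero |>.mp (by exact_mod_cast h1.symm))
  have hcabs : (weilStdGramMatrix n d a b).det = ((c.natAbs : ℚ)) ^ 2 := by
    rw [hStd, Nat.cast_natAbs, Int.cast_abs, sq_abs]
  have hcpos : (0 : ℚ) < (c.natAbs : ℚ) := by
    exact_mod_cast Int.natAbs_pos.mpr hc0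
  have h := det_eq_neg_one_pow_mul_of_sq hdpos ha hb hq hcabs hcpos hsign
  rw [h, ← mul_assoc, ← pow_add, ← two_mul, pow_mul, neg_one_sq, one_pow, one_mul]

/-- **Split test, lattice form: `[det Ψ]` is the SPLIT class `[(-1)ⁿ]` of `ℚˣ/Nm(K_dˣ)` iff
`|det P| · d₁⋯d_g ∈ Nm(K_dˣ)`** — the census column «split special fibre?» decided from a period lattice by
(index of a `K`-frame) × (polarisation type).
research route conditional on HC_CM; not a corollary; Q11.4-sentence-2 already refuted in dim ≥ 3.
[cite: vanGeemen1994HodgeAV, 5.4 and (5.4.1)] -/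
theorem mk_det_eq_splitDiscriminantClass_iff_of_frame (hd : IsPolarizationType Φ ω dtyp) (hdpos : 0 < d)
    (e : Fin (4 * n) ≃ ι) (P : Matrix (Fin (4 * n)) (Fin (4 * n)) ℤ)
    (hF : (Matrix.of fun j j' =>
        ω ![Φ (intVec fun i => P (e.symm i) j), Φ (intVec fun i => P (e.symm i) j')]) =
      (weilStdGramMatrix n d a b).map (Rat.cast : ℚ → ℝ))
    (ha : a.IsSymm) (hb : bᵀ = -b) (hq : (weilGramMatrix d a b).det = algebraMap ℚ (weilField d) q)
    (hsign : 0 < (-1 : ℚ) ^ n * q) (hq0 : q ≠ 0)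
    (hc0 : ((P.det * ∏ i, (dtyp i : ℤ)).natAbs : ℚ) ≠ 0) :
    (QuotientGroup.mk (Units.mk0 q hq0) : weilNormResidueGroup d) = splitDiscriminantClass n d ↔
      Units.mk0 (((P.det * ∏ i, (dtyp i : ℤ)).natAbs : ℚ)) hc0 ∈ normUnitsSubgroup ℚ (weilField d) := by
  have h := neg_one_pow_mul_det_eq_natAbs_of_frame hd hdpos e P hF ha hb hq hsign
  have hq' : Units.mk0 q hq0 = (-1 : ℚˣ) ^ n * Units.mk0 (((P.det * ∏ i, (dtyp i : ℤ)).natAbs : ℚ)) hc0 := by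
    ext
    simp only [Units.val_mk0, Units.val_mul, Units.val_pow_eq_pow_val, Units.val_neg, Units.val_one]
    rw [← h, ← mul_assoc, ← pow_add, ← two_mul, pow_mul, neg_one_sq, one_pow, one_mul]
  rw [hq', mk_neg_one_pow_mul_eq_splitDiscriminantClass_iff]

end Weil

end Summit.HodgeConjecture.HodgeConjecture.Ring2.WeilCoverage
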